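import Literature.Analysis.FluidPDE.HeatDivFormImprovementProofs
import HarnessLib

/-!
# The `L^m → L^r` improvement for `∂ₜw - Δw = div g` up to the top of the cylinder

Analysis/FluidPDE proofs file (theorems only; no definitions, no named facts). The accepted
`HeatDivFormInteriorImprovement_holds` (`HeatDivFormImprovementProofs.lean`; Robinson–Rodrigo–
Sadowski 2016, proof of Thm. 13.7, §13.3.2 Step 2 with Thms. D.6–D.7, isotropic exponents) improves
`w ∈ L^m(Q*_ρ(z))` to `w ∈ L^r(Q*_{ρ'}(z))` on *centred* cylinders, losing a layer at both time
ends. The printed argument loses nothing at the top: the Duhamel integral (D.2),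
`W(t) = ∫_{t₀}^t e^{(t-s)Δ}(RHS)(s) ds`, only looks into the past. This file proves the statement
**up to the top** of a product cylinder `]a, T[ × B(x₀, ρ)`: if `w, g ∈ L^m` there satisfy
`∂ₜw - Δw = div g` in `𝒟'`, `1 < m ≤ r ≤ ∞`, `1/m < 1/r + 1/5`, then `w ∈ L^r(]a', T[ × B(x₀, ρ'))`
for all `a < a'`, `ρ' < ρ` (`heatDivForm_improvement_top`). This is the form needed for
parabolic interior regularity up to the final time (e.g. Escauriaza–Seregin–Šverák 2003,
Lemma 2.2: Hölder continuity on the *closed* cylinder `Q̄(1/2)`).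

## Proof

The duality proof of the accepted file, with one change. The cut-off is `φ(t, x) = ζ(t) θ(x)`
with `ζ = 1` on `[a', T + 1]`, `ζ = 0` below `(a + a')/2`, `θ = 1` on `B(x₀, ρ')`,
`supp θ ⊆ B(x₀, ρ)` (`exists_top_cutoff`); it is *not* compactly supported in the open cylinder
`Q`. But the equation is only ever tested with `ψ = φ 𝒰[Θ]`, `𝒰[Θ] = heatDuhamelBack 1 Θ` the
backward caloric Duhamel integral of a test function `Θ` supported in the half-space `{t < T}`:
`𝒰[Θ]` vanishes above the time support of `Θ` (`heatDuhamelBack_eq_zero_of_le`), so `φ 𝒰[Θ]`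
*is* compactly supported in `Q` (`isSpaceTimeTestOn_mul_of_eq_zero_of_le`). The identity
`∫ φ w Θ = ∫ locH·𝒰[Θ] - Σᵢ ∫ locFᵢ ∂ᵢ𝒰[Θ]` (`integral_cutoff_mul_mul_test_eq_of_test`, the
accepted computation with the test property of `φ 𝒰[Θ]` as a hypothesis), the representation by
forward potentials, the truncation of the kernels on `{t < T}`, Young's inequality and
du Bois-Reymond on the half-space `{t < T}` then run verbatim, and `φ w = w` on
`]a', T[ × B(x₀, ρ')`.

## References

* J. C. Robinson, J. L. Rodrigo, W. Sadowski, *The Three-Dimensional Navier–Stokes Equations.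
  Classical theory*, CUP 2016: §13.3.2 Steps 1–2, (13.11)–(13.17); App. D, (D.2), Thms. D.6–D.7.
  [`RobinsonRodrigoSadowskiCUP2016`]
* L. Escauriaza, G. Seregin, V. Šverák, *`L_{3,∞}`-solutions of Navier–Stokes equations and
  backward uniqueness*, Russ. Math. Surveys 58 (2003), Lemma 2.2 (regularity up to the top of
  `Q(1/2)`). [`EscauriazaSereginSverak2003`]
-/

noncomputable section

open MeasureTheory Set Function Filter Topology TopologicalSpace Metric
open scoped NNReal ENNReal RealInnerProductSpace Laplacian Convolution

namespace Literature.Analysis.FluidPDE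

namespace HeatDivForm

section General

variable {E : Type*} [NormedAddCommGroup E] [InnerProductSpace ℝ E] [FiniteDimensional ℝ E]
  [MeasurableSpace E] [BorelSpace E]
variable {ι : Type*} [Fintype ι]

/-! ### Test fields of the form `φ · U` with `U` vanishing near the top -/

omit [MeasurableSpace E] [BorelSpace E] [FiniteDimensional ℝ E] [InnerProductSpace ℝ E] in
/-- **A global cut-off times a smooth field vanishing above time `b` is a test field on `Q`**
as soon as the part of the support of the cut-off below time `b` lies in `Q`. [folklore] -/
theorem isSpaceTimeTestOn_mul_of_eq_zero_of_le [NormedSpace ℝ E] {Q : Opens (ℝ × E)}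
    {φ U : ℝ → E → ℝ} (hφ : IsSpaceTimeTestOn (⊤ : Opens (ℝ × E)) φ)
    (hU : ContDiff ℝ ((⊤ : ℕ∞) : WithTop ℕ∞) (uncurry U)) {b : ℝ}
    (hUb : ∀ s, b ≤ s → ∀ x, U s x = 0)
    (hsub : ∀ q ∈ tsupport (uncurry φ), q.1 ≤ b → q ∈ (Q : Set (ℝ × E))) :
    IsSpaceTimeTestOn Q (fun t x => φ t x * U t x) := by
  have hprod : (uncurry fun t x => φ t x * U t x) = fun q => uncurry φ q * uncurry U q := by
    funext q; rfl
  refine ⟨?_, ?_, ?_⟩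
  · rw [hprod]; exact hφ.contDiff.mul hU
  · rw [hprod]; exact hφ.hasCompactSupport.mul_right
  · intro q hq
    rw [hprod] at hq
    have h1 : q ∈ tsupport (uncurry φ) := tsupport_mul_subset_left hq
    have h2 : q.1 ≤ b := by
      have hsupp : Function.support (fun q : ℝ × E => uncurry φ q * uncurry U q) ⊆ {q | q.1 ≤ b} := by
        intro q' hq'
        rw [Function.mem_support] at hq'
        by_contra hlt
        simp only [mem_setOf_eq, not_le] at hlt
        exact hq' (by simp [uncurry, hUb q'.1 hlt.le q'.2])
      have hcl : IsClosed {q : ℝ × E | q.1 ≤ b} := isClosed_le continuous_fst continuous_const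
      exact (closure_minimal hsupp hcl) hq
    exact hsub q h1 h2

omit [MeasurableSpace E] [BorelSpace E] [FiniteDimensional ℝ E] [InnerProductSpace ℝ E] in
/-- A space–time test field on the half-space `{t < T}` has its time support in a compact
interval `[a, b]` with `b < T` (the projection of the compact support to the time axis is compact
and contained in `]-∞, T[`; twin of the accepted `IsSpaceTimeTestOn.exists_time_support_lt` of
`AncientMildWeak.lean`, which is not in the import closure). [folklore] -/
theorem exists_time_support_lt_top [NormedSpace ℝ E] {T : ℝ} {ψ : ℝ → E → ℝ}
    (hψc : HasCompactSupport (uncurry ψ))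
    (hψT : tsupport (uncurry ψ) ⊆ {q : ℝ × E | q.1 < T}) :
    ∃ a b : ℝ, a ≤ b ∧ b < T ∧ ∀ t, t ∉ Icc a b → ψ t = 0 := by
  rcases (tsupport (uncurry ψ)).eq_empty_or_nonempty with h0 | hne
  · have hz : uncurry ψ = 0 := tsupport_eq_empty_iff.1 h0
    refine ⟨T - 1, T - 1, le_rfl, by linarith, fun t _ => funext fun x => ?_⟩
    exact congrFun hz (t, x)
  · have hK : IsCompact (tsupport (uncurry ψ)) := hψc
    obtain ⟨z₁, hz₁, hmax⟩ := hK.exists_isMaxOn hne continuous_fst.continuousOn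
    obtain ⟨z₀, hz₀, hmin⟩ := hK.exists_isMinOn hne continuous_fst.continuousOn
    have hb : z₁.1 < T := hψT hz₁
    refine ⟨z₀.1, z₁.1, hmin hz₁, hb, fun t ht => funext fun x => ?_⟩
    by_contra hx
    have hmem : (t, x) ∈ tsupport (uncurry ψ) := subset_tsupport _ hx
    exact ht ⟨hmin hmem, hmax hmem⟩

/-! ### The duality identity with the test property of `φ 𝒰[Θ]` as a hypothesis -/

/-- **Localisation and duality** (the accepted `integral_cutoff_mul_mul_test_eq`, with the
test property of `ψ = φ 𝒰[Θ]` on `Q` assumed instead of `φ ∈ C_c^∞(Q)`; `φ` is any global test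
field). Testing `∂ₜw - Δw = div g` on `Q` with `ψ` and expanding gives
`∫ φ w Θ = ∫ locH·𝒰[Θ] - Σᵢ ∫ locFᵢ ∂ᵢ𝒰[Θ]`.
[cite: RobinsonRodrigoSadowskiCUP2016, §13.3.2 Step 1, (13.11)–(13.12)] -/
theorem integral_cutoff_mul_mul_test_eq_of_test (b : OrthonormalBasis ι ℝ E) {Q : Opens (ℝ × E)}
    {w : ℝ × E → ℝ} {g : ℝ × E → E} (hw : Integrable w (volume : Measure (ℝ × E)))
    (hg : Integrable g (volume : Measure (ℝ × E)))
    (heq : ∀ ψ : ℝ → E → ℝ, IsSpaceTimeTestOn Q ψ →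
      ∫ q : ℝ × E, w q * (timeDeriv ψ q.1 q.2 + (Δ (ψ q.1)) q.2) =
        ∫ q : ℝ × E, ⟪g q, gradient (ψ q.1) q.2⟫)
    {φ : ℝ → E → ℝ} (hφ : IsSpaceTimeTestOn (⊤ : Opens (ℝ × E)) φ) {Θ : ℝ → E → ℝ}
    (hΘ : IsSpaceTimeTestOn (⊤ : Opens (ℝ × E)) Θ)
    (hψ : IsSpaceTimeTestOn Q (fun t x => φ t x * heatDuhamelBack 1 Θ t x)) :
    ∫ q : ℝ × E, φ q.1 q.2 * w q * Θ q.1 q.2 =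
      (∫ q : ℝ × E, locH b φ w g q * heatDuhamelBack 1 Θ q.1 q.2) -
        ∑ i, ∫ q : ℝ × E, locF b φ w g i q * fderiv ℝ (heatDuhamelBack 1 Θ q.1) q.2 (b i) := by
  set U : ℝ → E → ℝ := heatDuhamelBack 1 Θ with hU
  have hUs : ContDiff ℝ ((⊤ : ℕ∞) : WithTop ℕ∞) (uncurry U) :=
    hΘ.contDiff_uncurry_heatDuhamelBack_infty one_pos
  have hφs : ContDiff ℝ ((⊤ : ℕ∞) : WithTop ℕ∞) (uncurry φ) := hφ.contDiff
  have key := heq _ hψ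
  -- pointwise expansions
  have hφ2 : ∀ t, ContDiff ℝ 2 (φ t) := fun t => (hφ.contDiff_slice t).of_le two_le_infty
  have hU2 : ∀ t, ContDiff ℝ 2 (U t) := fun t => (contDiff_slice_of_uncurry hUs t).of_le two_le_infty
  have hheat : ∀ t x, timeDeriv U t x + (Δ (U t)) x = -Θ t x := fun t x =>
    timeDeriv_add_laplacian_heatDuhamelBack_one hΘ t x
  have hL : ∀ q : ℝ × E, w q * (timeDeriv (fun t x => φ t x * U t x) q.1 q.2 +
      (Δ (fun x => φ q.1 x * U q.1 x)) q.2) =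
      -(φ q.1 q.2 * w q * Θ q.1 q.2) +
        w q * ((timeDeriv φ q.1 q.2 + (Δ (φ q.1)) q.2) * U q.1 q.2) +
        2 * ∑ i, w q * (fderiv ℝ (φ q.1) q.2 (b i) * fderiv ℝ (U q.1) q.2 (b i)) := by
    rintro ⟨t, x⟩
    have e1 : timeDeriv (fun t x => φ t x * U t x) t x =
        timeDeriv φ t x * U t x + φ t x * timeDeriv U t x :=
      timeDeriv_mul (differentiableAt_time_of_uncurry hφs (by simp) t x)
        (differentiableAt_time_of_uncurry hUs (by simp) t x)
    have e2 := laplacian_mul_eq b (hφ2 t) (hU2 t) x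
    have hs : ∑ i, w (t, x) * (fderiv ℝ (φ t) x (b i) * fderiv ℝ (U t) x (b i)) =
        w (t, x) * ∑ i, fderiv ℝ (φ t) x (b i) * fderiv ℝ (U t) x (b i) := by
      rw [Finset.mul_sum]
    simp only
    rw [e1, e2, hs]
    have := hheat t x
    have e3 : φ t x * timeDeriv U t x + φ t x * (Δ (U t)) x = -(φ t x * Θ t x) := by
      rw [← mul_add, this, mul_neg]
    linear_combination w (t, x) * e3
  have hR : ∀ q : ℝ × E, ⟪g q, gradient (fun x => φ q.1 x * U q.1 x) q.2⟫ =
      ∑ i, ⟪g q, b i⟫ * (fderiv ℝ (φ q.1) q.2 (b i) * U q.1 q.2) +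
        ∑ i, ⟪g q, b i⟫ * (φ q.1 q.2 * fderiv ℝ (U q.1) q.2 (b i)) := by
    rintro ⟨t, x⟩
    have hφd : DifferentiableAt ℝ (φ t) x := ((hφ.contDiff_slice t).differentiable (by simp)) x
    have hUd : DifferentiableAt ℝ (U t) x :=
      ((contDiff_slice_of_uncurry hUs t).differentiable (by simp)) x
    simp only
    rw [real_inner_gradient_right, fderiv_apply_eq_sum_inner b, ← Finset.sum_add_distrib]
    refine Finset.sum_congr rfl fun i _ => ?_
    rw [fderiv_fun_mul hφd hUd]
    simp only [_root_.add_apply, FunLike.coe_smul, Pi.smul_apply, smul_eq_mul]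
    ring
  simp_rw [hL, hR] at key
  -- continuity and compact support of the smooth factors
  have cU : Continuous fun q : ℝ × E => U q.1 q.2 := hUs.continuous
  have cdU : ∀ i, Continuous fun q : ℝ × E => fderiv ℝ (U q.1) q.2 (b i) := fun i =>
    continuous_fderiv_slice_apply_of_contDiff hUs (b i)
  have cφ : Continuous fun q : ℝ × E => φ q.1 q.2 := hφs.continuous
  have cdφ : ∀ i, Continuous fun q : ℝ × E => fderiv ℝ (φ q.1) q.2 (b i) := fun i =>
    continuous_fderiv_slice_apply_of_contDiff hφs (b i)
  have cχ : Continuous fun q : ℝ × E => timeDeriv φ q.1 q.2 + (Δ (φ q.1)) q.2 :=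
    (continuous_timeDeriv_of_contDiff hφs).add (continuous_laplacian_slice_of_contDiff hφs)
  have cΘ : Continuous fun q : ℝ × E => Θ q.1 q.2 := hΘ.contDiff.continuous
  have sφ : HasCompactSupport fun q : ℝ × E => φ q.1 q.2 := hφ.hasCompactSupport
  have sdφ : ∀ i, HasCompactSupport fun q : ℝ × E => fderiv ℝ (φ q.1) q.2 (b i) := fun i =>
    (hφ.fderiv_apply_top (b i)).hasCompactSupport
  have sχ : HasCompactSupport fun q : ℝ × E => timeDeriv φ q.1 q.2 + (Δ (φ q.1)) q.2 :=
    hφ.timeDeriv_top.hasCompactSupport.add hφ.laplacian_top.hasCompactSupport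
  -- the coordinates of `g` are integrable
  have hgi : ∀ i, Integrable (fun q : ℝ × E => ⟪g q, b i⟫) (volume : Measure (ℝ × E)) := fun i =>
    hg.inner_const (b i)
  -- integrability of the five kinds of terms
  have I1 : Integrable (fun q : ℝ × E => φ q.1 q.2 * w q * Θ q.1 q.2) (volume : Measure (ℝ × E)) := by
    have h : Integrable (fun q : ℝ × E => w q * (φ q.1 q.2 * Θ q.1 q.2)) (volume : Measure (ℝ × E)) :=
      integrable_mul_of_continuous_hasCompactSupport hw (cφ.mul cΘ) (sφ.mul_right)
    refine h.congr (Eventually.of_forall fun q => ?_)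
    simp only; ring
  have I2 : Integrable (fun q : ℝ × E =>
      w q * ((timeDeriv φ q.1 q.2 + (Δ (φ q.1)) q.2) * U q.1 q.2)) (volume : Measure (ℝ × E)) :=
    integrable_mul_of_continuous_hasCompactSupport hw (cχ.mul cU) sχ.mul_right
  have I3 : ∀ i, Integrable (fun q : ℝ × E =>
      w q * (fderiv ℝ (φ q.1) q.2 (b i) * fderiv ℝ (U q.1) q.2 (b i))) (volume : Measure (ℝ × E)) :=
    fun i => integrable_mul_of_continuous_hasCompactSupport hw ((cdφ i).mul (cdU i)) (sdφ i).mul_right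
  have I4 : ∀ i, Integrable (fun q : ℝ × E =>
      ⟪g q, b i⟫ * (fderiv ℝ (φ q.1) q.2 (b i) * U q.1 q.2)) (volume : Measure (ℝ × E)) :=
    fun i => integrable_mul_of_continuous_hasCompactSupport (hgi i) ((cdφ i).mul cU) (sdφ i).mul_right
  have I5 : ∀ i, Integrable (fun q : ℝ × E =>
      ⟪g q, b i⟫ * (φ q.1 q.2 * fderiv ℝ (U q.1) q.2 (b i))) (volume : Measure (ℝ × E)) :=
    fun i => integrable_mul_of_continuous_hasCompactSupport (hgi i) (cφ.mul (cdU i)) sφ.mul_right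
  -- evaluate both sides of `key`
  have I3s : Integrable (fun q : ℝ × E =>
      ∑ i, w q * (fderiv ℝ (φ q.1) q.2 (b i) * fderiv ℝ (U q.1) q.2 (b i))) (volume : Measure (ℝ × E)) :=
    integrable_finsetSum _ fun i _ => I3 i
  have I3s2 : Integrable (fun q : ℝ × E =>
      2 * ∑ i, w q * (fderiv ℝ (φ q.1) q.2 (b i) * fderiv ℝ (U q.1) q.2 (b i))) (volume : Measure (ℝ × E)) :=
    I3s.const_mul 2
  have hLint : ∫ q : ℝ × E, (-(φ q.1 q.2 * w q * Θ q.1 q.2) +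
      w q * ((timeDeriv φ q.1 q.2 + (Δ (φ q.1)) q.2) * U q.1 q.2) +
      2 * ∑ i, w q * (fderiv ℝ (φ q.1) q.2 (b i) * fderiv ℝ (U q.1) q.2 (b i))) =
      -(∫ q : ℝ × E, φ q.1 q.2 * w q * Θ q.1 q.2) +
        (∫ q : ℝ × E, w q * ((timeDeriv φ q.1 q.2 + (Δ (φ q.1)) q.2) * U q.1 q.2)) +
        2 * ∑ i, ∫ q : ℝ × E, w q * (fderiv ℝ (φ q.1) q.2 (b i) * fderiv ℝ (U q.1) q.2 (b i)) := by
    have I1n : Integrable (fun q : ℝ × E => -(φ q.1 q.2 * w q * Θ q.1 q.2)) (volume : Measure (ℝ × E)) :=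
      I1.neg
    have I12 : Integrable (fun q : ℝ × E => -(φ q.1 q.2 * w q * Θ q.1 q.2) +
        w q * ((timeDeriv φ q.1 q.2 + (Δ (φ q.1)) q.2) * U q.1 q.2)) (volume : Measure (ℝ × E)) :=
      I1n.add I2
    rw [integral_add I12 I3s2, integral_add I1n I2, integral_neg, integral_const_mul,
      integral_finsetSum _ fun i _ => I3 i]
  have hRint : ∫ q : ℝ × E, (∑ i, ⟪g q, b i⟫ * (fderiv ℝ (φ q.1) q.2 (b i) * U q.1 q.2) +
      ∑ i, ⟪g q, b i⟫ * (φ q.1 q.2 * fderiv ℝ (U q.1) q.2 (b i))) =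
      (∑ i, ∫ q : ℝ × E, ⟪g q, b i⟫ * (fderiv ℝ (φ q.1) q.2 (b i) * U q.1 q.2)) +
        ∑ i, ∫ q : ℝ × E, ⟪g q, b i⟫ * (φ q.1 q.2 * fderiv ℝ (U q.1) q.2 (b i)) := by
    rw [integral_add (integrable_finsetSum _ fun i _ => I4 i) (integrable_finsetSum _ fun i _ => I5 i),
      integral_finsetSum _ fun i _ => I4 i, integral_finsetSum _ fun i _ => I5 i]
  rw [hLint, hRint] at key
  -- the right-hand side of the claim
  have eH : ∫ q : ℝ × E, locH b φ w g q * U q.1 q.2 =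
      (∫ q : ℝ × E, w q * ((timeDeriv φ q.1 q.2 + (Δ (φ q.1)) q.2) * U q.1 q.2)) -
        ∑ i, ∫ q : ℝ × E, ⟪g q, b i⟫ * (fderiv ℝ (φ q.1) q.2 (b i) * U q.1 q.2) := by
    rw [← integral_finsetSum _ fun i _ => I4 i, ← integral_sub I2 (integrable_finsetSum _ fun i _ => I4 i)]
    refine integral_congr_ae (Eventually.of_forall fun q => ?_)
    simp only [locH, Finset.sum_mul, sub_mul]
    congr 1
    · ring
    · exact Finset.sum_congr rfl fun i _ => by ring
  have eF : ∀ i, ∫ q : ℝ × E, locF b φ w g i q * fderiv ℝ (U q.1) q.2 (b i) =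
      (∫ q : ℝ × E, ⟪g q, b i⟫ * (φ q.1 q.2 * fderiv ℝ (U q.1) q.2 (b i))) -
        2 * ∫ q : ℝ × E, w q * (fderiv ℝ (φ q.1) q.2 (b i) * fderiv ℝ (U q.1) q.2 (b i)) := by
    intro i
    rw [← integral_const_mul, ← integral_sub (I5 i) ((I3 i).const_mul 2)]
    refine integral_congr_ae (Eventually.of_forall fun q => ?_)
    simp only [locF]
    ring
  rw [eH, Finset.sum_congr rfl fun i _ => eF i, Finset.sum_sub_distrib, ← Finset.mul_sum]
  linarith [key]

/-- **The localised solution is a sum of forward heat potentials, in the sense of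
distributions** (the accepted `integral_cutoff_mul_mul_test_eq_potentials` with the test property
of `φ 𝒰[Θ]` assumed): `∫ φ w Θ̃ = ∫ Θ̃ · (Φ ⋆ locH) - Σᵢ ∫ Θ̃ · (Φᵢ ⋆ locFᵢ)`.
[cite: RobinsonRodrigoSadowskiCUP2016, App. D (D.2) with §13.3.2 Step 1 (13.11)–(13.12)] -/
theorem integral_cutoff_mul_mul_test_eq_potentials_of_test (b : OrthonormalBasis ι ℝ E)
    {Q : Opens (ℝ × E)} {w : ℝ × E → ℝ} {g : ℝ × E → E}
    (hw : Integrable w (volume : Measure (ℝ × E))) (hg : Integrable g (volume : Measure (ℝ × E)))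
    (heq : ∀ ψ : ℝ → E → ℝ, IsSpaceTimeTestOn Q ψ →
      ∫ q : ℝ × E, w q * (timeDeriv ψ q.1 q.2 + (Δ (ψ q.1)) q.2) =
        ∫ q : ℝ × E, ⟪g q, gradient (ψ q.1) q.2⟫)
    {φ : ℝ → E → ℝ} (hφ : IsSpaceTimeTestOn (⊤ : Opens (ℝ × E)) φ) {Θ : ℝ → E → ℝ}
    (hΘ : IsSpaceTimeTestOn (⊤ : Opens (ℝ × E)) Θ)
    (hψ : IsSpaceTimeTestOn Q (fun t x => φ t x * heatDuhamelBack 1 Θ t x)) :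
    ∫ q : ℝ × E, φ q.1 q.2 * w q * Θ q.1 q.2 =
      (∫ q : ℝ × E, uncurry Θ q *
        (fwdKernel (UnboundedOperators.heatKernel (E := E))
          ⋆[ContinuousLinearMap.lsmul ℝ ℝ, (volume : Measure (ℝ × E))] locH b φ w g) q) -
      ∑ i, ∫ q : ℝ × E, uncurry Θ q *
        (fwdKernel (heatKernelGrad (b i))
          ⋆[ContinuousLinearMap.lsmul ℝ ℝ, (volume : Measure (ℝ × E))] locF b φ w g i) q := by
  rw [integral_cutoff_mul_mul_test_eq_of_test b hw hg heq hφ hΘ hψ]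
  obtain ⟨a', b', hab'⟩ := exists_time_bounds_of_isSpaceTimeTestOn hφ
  have hHsupp : ∀ q, locH b φ w g q ≠ 0 → q.1 ∈ Icc a' b' := fun q hq =>
    hab' q (by by_contra h; exact hq (locH_eq_zero_of_notMem b w g h))
  have hFsupp : ∀ i q, locF b φ w g i q ≠ 0 → q.1 ∈ Icc a' b' := fun i q hq =>
    hab' q (by by_contra h; exact hq (locF_eq_zero_of_notMem b w g i h))
  have e1 : ∫ q : ℝ × E, locH b φ w g q * heatDuhamelBack 1 Θ q.1 q.2 =
      ∫ q : ℝ × E, uncurry Θ q *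
        (fwdKernel (UnboundedOperators.heatKernel (E := E))
          ⋆[ContinuousLinearMap.lsmul ℝ ℝ, (volume : Measure (ℝ × E))] locH b φ w g) q := by
    rw [← integral_mul_conv_eq_integral_test_mul_fwd isSliceBoundKernel_backKernel_heatKernel hΘ
      (integrable_locH b hφ hw hg) hHsupp]
    refine integral_congr_ae (Eventually.of_forall fun q => ?_)
    simp only
    rw [heatDuhamelBack_one_eq_convolution_heatKernel hΘ q.1 q.2]
  have e2 : ∀ i, ∫ q : ℝ × E, locF b φ w g i q * fderiv ℝ (heatDuhamelBack 1 Θ q.1) q.2 (b i) =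
      ∫ q : ℝ × E, uncurry Θ q *
        (fwdKernel (heatKernelGrad (b i))
          ⋆[ContinuousLinearMap.lsmul ℝ ℝ, (volume : Measure (ℝ × E))] locF b φ w g i) q := by
    intro i
    rw [← integral_mul_conv_eq_integral_test_mul_fwd (isSliceBoundKernel_backKernel_heatKernelGrad (b i))
      hΘ (integrable_locF b hφ hw hg i) (hFsupp i)]
    refine integral_congr_ae (Eventually.of_forall fun q => ?_)
    simp only
    rw [fderiv_heatDuhamelBack_one_eq_convolution_heatKernelGrad hΘ q.1 q.2 (b i)]
  rw [e1, Finset.sum_congr rfl fun i _ => e2 i]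

end General

/-! ## The improvement up to the top in `ℝ³` -/

section R3

/-- **A product cut-off reaching over the top.** For `a < a' < T` and `0 < ρ' < ρ` there is a
global test field `φ = ζ(t) θ(x)` on `ℝ × ℝ³` with `φ = 1` on `[a', T + 1] × B(x₀, ρ')` whose
support lies in `{t ≥ (a + a')/2} × B̄(x₀, (ρ' + ρ)/2)` (product of Mathlib bump functions).
[folklore] -/
theorem exists_top_cutoff {a a' T ρ ρ' : ℝ} (haa' : a < a') (ha'T : a' < T) (hρ' : 0 < ρ')
    (h : ρ' < ρ) (x₀ : (EuclideanSpace ℝ (Fin 3))) :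
    ∃ φ : ℝ → (EuclideanSpace ℝ (Fin 3)) → ℝ, IsSpaceTimeTestOn (⊤ : Opens (ℝ × (EuclideanSpace ℝ (Fin 3)))) φ ∧
      (∀ q : ℝ × (EuclideanSpace ℝ (Fin 3)), q ∈ tsupport (uncurry φ) →
        (a + a') / 2 ≤ q.1 ∧ dist q.2 x₀ ≤ (ρ' + ρ) / 2) ∧
      ∀ q : ℝ × (EuclideanSpace ℝ (Fin 3)), q.1 ∈ Icc a' (T + 1) → q.2 ∈ ball x₀ ρ' → φ q.1 q.2 = 1 := by
  -- the two bumps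
  let ζ : ContDiffBump ((a' + (T + 1)) / 2 : ℝ) :=
    ⟨(T + 1 - a') / 2, (T + 1 - a') / 2 + (a' - a) / 2, by linarith, by linarith⟩
  let θ : ContDiffBump x₀ := ⟨ρ', (ρ' + ρ) / 2, hρ', by linarith⟩
  have hζout : ζ.rOut = (T + 1 - a') / 2 + (a' - a) / 2 := rfl
  have hθout : θ.rOut = (ρ' + ρ) / 2 := rfl
  -- the support of the product
  have hsub : Function.support (uncurry fun t x => ζ t * θ x) ⊆
      closedBall ((a' + (T + 1)) / 2) ζ.rOut ×ˢ closedBall x₀ θ.rOut := by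
    intro q hq
    rw [Function.mem_support] at hq
    simp only [uncurry] at hq
    have h1 : ζ q.1 ≠ 0 := left_ne_zero_of_mul hq
    have h2 : θ q.2 ≠ 0 := right_ne_zero_of_mul hq
    have h1' : q.1 ∈ Function.support (ζ : ℝ → ℝ) := h1
    have h2' : q.2 ∈ Function.support (θ : (EuclideanSpace ℝ (Fin 3)) → ℝ) := h2
    rw [ζ.support_eq] at h1'
    rw [θ.support_eq] at h2'
    exact ⟨ball_subset_closedBall h1', ball_subset_closedBall h2'⟩
  have htsupp : tsupport (uncurry fun t x => ζ t * θ x) ⊆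
      closedBall ((a' + (T + 1)) / 2) ζ.rOut ×ˢ closedBall x₀ θ.rOut :=
    closure_minimal hsub ((isClosed_closedBall).prod isClosed_closedBall)
  refine ⟨fun t x => ζ t * θ x, ⟨?_, ?_, fun _ _ => trivial⟩, ?_, ?_⟩
  · exact (ζ.contDiff.comp contDiff_fst).mul (θ.contDiff.comp contDiff_snd)
  · exact HasCompactSupport.intro' ((isCompact_closedBall _ ζ.rOut).prod
      (isCompact_closedBall x₀ θ.rOut)) ((isClosed_closedBall).prod isClosed_closedBall)
      fun q hq => by
        by_contra hne
        exact hq (hsub (Function.mem_support.2 hne))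
  · intro q hq
    obtain ⟨h1, h2⟩ := htsupp hq
    rw [mem_closedBall, Real.dist_eq, hζout] at h1
    rw [mem_closedBall, hθout] at h2
    refine ⟨?_, h2⟩
    have := (abs_le.1 h1).1
    linarith
  · rintro ⟨t, x⟩ ht hx
    simp only at ht hx
    have h1 : ζ t = 1 := ζ.one_of_mem_closedBall (by
      rw [mem_closedBall, Real.dist_eq]
      change |t - (a' + (T + 1)) / 2| ≤ (T + 1 - a') / 2
      rw [abs_le]
      constructor <;> linarith [ht.1, ht.2])
    have h2 : θ x = 1 := θ.one_of_mem_closedBall (by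
      rw [mem_closedBall]
      exact (mem_ball.1 hx).le)
    simp [h1, h2]

/-- The volume of a product cylinder `]a, T[ × B(x₀, ρ)` is finite. [folklore] -/
theorem volume_Ioo_prod_ball_lt_top (a T : ℝ) (x₀ : (EuclideanSpace ℝ (Fin 3))) (ρ : ℝ) :
    volume (Ioo a T ×ˢ ball x₀ ρ) < ⊤ := by
  rw [Measure.volume_eq_prod, Measure.prod_prod]
  exact ENNReal.mul_lt_top (by simp [Real.volume_Ioo]) measure_ball_lt_top

/-- **The `L^m → L^r` improvement for `∂ₜw - Δw = div g`, up to the top of the cylinder**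
(Robinson–Rodrigo–Sadowski 2016, proof of Thm. 13.7, §13.3.2 Step 2 with Thms. D.6–D.7 and the
Duhamel formula (D.2), isotropic exponents). Let `Q = ]a, T[ × B(x₀, ρ)`, `1 < m ≤ r ≤ ∞` with
`1/m < 1/r + 1/5`, `a < a' < T`, `0 < ρ' < ρ`, and let `w, g ∈ L^m(Q)` satisfy
`∫ w (∂ₜψ + Δψ) = ∫ ⟪g, ∇ψ⟫` for all `ψ ∈ C_c^∞(Q)`. Then `w ∈ L^r(]a', T[ × B(x₀, ρ'))` — no
layer is lost at the top time `T`. Proof: module docstring.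
[cite: RobinsonRodrigoSadowskiCUP2016, §13.3.2 Step 2 ((13.11)–(13.16)) with Thms. D.6–D.7 (isotropic case) and (D.2)] -/
theorem heatDivForm_improvement_top {m r : ℝ≥0∞} {x₀ : (EuclideanSpace ℝ (Fin 3))} {a a' T ρ ρ' : ℝ}
    (h1m : 1 < m) (hmr : m ≤ r) (hexp : m⁻¹ < r⁻¹ + 5⁻¹) (haa' : a < a') (ha'T : a' < T)
    (hρ'0 : 0 < ρ') (hρ'ρ : ρ' < ρ) {w : ℝ × (EuclideanSpace ℝ (Fin 3)) → ℝ} {g : ℝ × (EuclideanSpace ℝ (Fin 3)) → (EuclideanSpace ℝ (Fin 3))}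
    (hw : MemLp w m (volume.restrict (Ioo a T ×ˢ ball x₀ ρ)))
    (hg : MemLp g m (volume.restrict (Ioo a T ×ˢ ball x₀ ρ)))
    (heq : ∀ ψ : ℝ → (EuclideanSpace ℝ (Fin 3)) → ℝ,
      IsSpaceTimeTestOn (⟨Ioo a T ×ˢ ball x₀ ρ, isOpen_Ioo.prod isOpen_ball⟩ : Opens (ℝ × (EuclideanSpace ℝ (Fin 3)))) ψ →
      ∫ q : ℝ × (EuclideanSpace ℝ (Fin 3)), w q * (timeDeriv ψ q.1 q.2 + (Δ (ψ q.1)) q.2) =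
        ∫ q : ℝ × (EuclideanSpace ℝ (Fin 3)), ⟪g q, gradient (ψ q.1) q.2⟫) :
    MemLp w r (volume.restrict (Ioo a' T ×ˢ ball x₀ ρ')) := by
  haveI := isAddLeftInvariant_volume_real_prod (E := (EuclideanSpace ℝ (Fin 3)))
  haveI := isAddRightInvariant_volume_real_prod (E := (EuclideanSpace ℝ (Fin 3)))
  haveI := isNegInvariant_volume_real_prod (E := (EuclideanSpace ℝ (Fin 3)))
  set Qs : Set (ℝ × (EuclideanSpace ℝ (Fin 3))) := Ioo a T ×ˢ ball x₀ ρ with hQs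
  set Qo : Opens (ℝ × (EuclideanSpace ℝ (Fin 3))) := ⟨Qs, isOpen_Ioo.prod isOpen_ball⟩ with hQo
  have hQmeas : MeasurableSet Qs := (isOpen_Ioo.prod isOpen_ball).measurableSet
  have hQfin : volume Qs < ⊤ := volume_Ioo_prod_ball_lt_top a T x₀ ρ
  haveI : IsFiniteMeasure ((volume : Measure (ℝ × (EuclideanSpace ℝ (Fin 3)))).restrict Qs) :=
    isFiniteMeasure_restrict.2 hQfin.ne
  have hm1 : 1 ≤ m := h1m.le
  have hr1 : 1 ≤ r := hm1.trans hmr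
  -- Step A: extension by zero
  set w' : ℝ × (EuclideanSpace ℝ (Fin 3)) → ℝ := Qs.indicator w with hw'
  set g' : ℝ × (EuclideanSpace ℝ (Fin 3)) → (EuclideanSpace ℝ (Fin 3)) := Qs.indicator g with hg'
  have hw'm : MemLp w' m (volume : Measure (ℝ × (EuclideanSpace ℝ (Fin 3)))) := (memLp_indicator_iff_restrict hQmeas).2 hw
  have hg'm : MemLp g' m (volume : Measure (ℝ × (EuclideanSpace ℝ (Fin 3)))) := (memLp_indicator_iff_restrict hQmeas).2 hg
  have hw'i : Integrable w' (volume : Measure (ℝ × (EuclideanSpace ℝ (Fin 3)))) :=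
    IntegrableOn.integrable_indicator (hw.integrable hm1) hQmeas
  have hg'i : Integrable g' (volume : Measure (ℝ × (EuclideanSpace ℝ (Fin 3)))) :=
    IntegrableOn.integrable_indicator (hg.integrable hm1) hQmeas
  have heq' : ∀ ψ : ℝ → (EuclideanSpace ℝ (Fin 3)) → ℝ, IsSpaceTimeTestOn Qo ψ →
      ∫ q : ℝ × (EuclideanSpace ℝ (Fin 3)), w' q * (timeDeriv ψ q.1 q.2 + (Δ (ψ q.1)) q.2) =
        ∫ q : ℝ × (EuclideanSpace ℝ (Fin 3)), ⟪g' q, gradient (ψ q.1) q.2⟫ := by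
    intro ψ hψ
    have e1 : (fun q : ℝ × (EuclideanSpace ℝ (Fin 3)) => w' q * (timeDeriv ψ q.1 q.2 + (Δ (ψ q.1)) q.2)) =
        fun q => w q * (timeDeriv ψ q.1 q.2 + (Δ (ψ q.1)) q.2) := by
      funext q
      by_cases hq : q ∈ Qs
      · rw [hw', indicator_of_mem hq]
      · have hq' : q ∉ tsupport (uncurry ψ) := fun h => hq (hψ.tsupport_subset h)
        rw [IsSpaceTimeTestOn.timeDeriv_eq_zero_of_notMem (ψ := ψ) (t := q.1) (x := q.2) hq',
          laplacian_slice_eq_zero_of_notMem_tsupport (ψ := ψ) (t := q.1) (x := q.2) hq']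
        simp
    have e2 : (fun q : ℝ × (EuclideanSpace ℝ (Fin 3)) => ⟪g' q, gradient (ψ q.1) q.2⟫) =
        fun q => ⟪g q, gradient (ψ q.1) q.2⟫ := by
      funext q
      by_cases hq : q ∈ Qs
      · rw [hg', indicator_of_mem hq]
      · have hq' : q ∉ tsupport (uncurry ψ) := fun h => hq (hψ.tsupport_subset h)
        rw [hψ.continuous_gradient_field.2.2 q hq']
        simp
    rw [e1, e2]
    exact heq ψ hψ
  -- Step B: the cut-off and the localised data
  obtain ⟨φ, hφ, hφsupp, hφ1⟩ := exists_top_cutoff haa' ha'T hρ'0 hρ'ρ x₀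
  obtain ⟨a₁, b₁, hab₁⟩ := exists_time_bounds_of_isSpaceTimeTestOn hφ
  set bs := stdOrthonormalBasis ℝ (EuclideanSpace ℝ (Fin 3)) with hbs
  set H : ℝ × (EuclideanSpace ℝ (Fin 3)) → ℝ := locH bs φ w' g' with hH
  set F : Fin (Module.finrank ℝ (EuclideanSpace ℝ (Fin 3))) → ℝ × (EuclideanSpace ℝ (Fin 3)) → ℝ := fun i => locF bs φ w' g' i with hF
  have hHm : MemLp H m (volume : Measure (ℝ × (EuclideanSpace ℝ (Fin 3)))) := memLp_locH bs hφ hw'm hg'm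
  have hFm : ∀ i, MemLp (F i) m (volume : Measure (ℝ × (EuclideanSpace ℝ (Fin 3)))) := fun i => memLp_locF bs hφ hw'm hg'm i
  have hHsupp : ∀ q, H q ≠ 0 → q.1 ∈ Icc a₁ b₁ := fun q hq =>
    hab₁ q (by by_contra h'; exact hq (locH_eq_zero_of_notMem bs w' g' h'))
  have hFsupp : ∀ i q, F i q ≠ 0 → q.1 ∈ Icc a₁ b₁ := fun i q hq =>
    hab₁ q (by by_contra h'; exact hq (locF_eq_zero_of_notMem bs w' g' i h'))
  -- Step C: the kernels and the potentials
  obtain ⟨p, hp1, hptop, hp54, hpm⟩ := exists_kernel_exponent h1m hmr hexp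
  set Tc : ℝ := T - a₁ with hTc
  have hd3 : Module.finrank ℝ (EuclideanSpace ℝ (Fin 3)) = 3 := by simp
  have hK0 : MemLp (fwdKernelCut (UnboundedOperators.heatKernel (E := (EuclideanSpace ℝ (Fin 3)))) Tc) p
      (volume : Measure (ℝ × (EuclideanSpace ℝ (Fin 3)))) :=
    memLp_fwdKernelCut_heatKernel Tc hp1 hptop (by
      rw [hd3]; norm_num; linarith)
  have hKi : ∀ i, MemLp (fwdKernelCut (heatKernelGrad (bs i)) Tc) p (volume : Measure (ℝ × (EuclideanSpace ℝ (Fin 3)))) :=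
    fun i => memLp_fwdKernelCut_heatKernelGrad (bs i) Tc hp1 hptop (by
      rw [hd3]; norm_num; linarith)
  set P0 : ℝ × (EuclideanSpace ℝ (Fin 3)) → ℝ := fwdKernelCut (UnboundedOperators.heatKernel (E := (EuclideanSpace ℝ (Fin 3)))) Tc
    ⋆[ContinuousLinearMap.lsmul ℝ ℝ, (volume : Measure (ℝ × (EuclideanSpace ℝ (Fin 3))))] H with hP0
  set Pi : Fin (Module.finrank ℝ (EuclideanSpace ℝ (Fin 3))) → ℝ × (EuclideanSpace ℝ (Fin 3)) → ℝ := fun i =>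
    fwdKernelCut (heatKernelGrad (bs i)) Tc ⋆[ContinuousLinearMap.lsmul ℝ ℝ, (volume : Measure (ℝ × (EuclideanSpace ℝ (Fin 3))))] F i
    with hPi
  have hP0m : MemLp P0 r (volume : Measure (ℝ × (EuclideanSpace ℝ (Fin 3)))) :=
    Convolution.memLp_convolution_of_memLp hp1 hm1 hpm hK0 hHm
  have hPim : ∀ i, MemLp (Pi i) r (volume : Measure (ℝ × (EuclideanSpace ℝ (Fin 3)))) := fun i =>
    Convolution.memLp_convolution_of_memLp hp1 hm1 hpm (hKi i) (hFm i)
  set V : ℝ × (EuclideanSpace ℝ (Fin 3)) → ℝ := fun q => P0 q - ∑ i, Pi i q with hV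
  have hVm : MemLp V r (volume : Measure (ℝ × (EuclideanSpace ℝ (Fin 3)))) := hP0m.sub (memLp_finsetSum _ fun i _ => hPim i)
  have hVloc : LocallyIntegrable V (volume : Measure (ℝ × (EuclideanSpace ℝ (Fin 3)))) := hVm.locallyIntegrable hr1
  have hP0loc : LocallyIntegrable P0 (volume : Measure (ℝ × (EuclideanSpace ℝ (Fin 3)))) := hP0m.locallyIntegrable hr1
  have hPiloc : ∀ i, LocallyIntegrable (Pi i) (volume : Measure (ℝ × (EuclideanSpace ℝ (Fin 3)))) := fun i =>
    (hPim i).locallyIntegrable hr1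
  -- the localised solution
  set W : ℝ × (EuclideanSpace ℝ (Fin 3)) → ℝ := fun q => φ q.1 q.2 * w' q with hW
  have hWi : Integrable W (volume : Measure (ℝ × (EuclideanSpace ℝ (Fin 3)))) := by
    have h : Integrable (fun q : ℝ × (EuclideanSpace ℝ (Fin 3)) => w' q * φ q.1 q.2) (volume : Measure (ℝ × (EuclideanSpace ℝ (Fin 3)))) :=
      integrable_mul_of_continuous_hasCompactSupport hw'i hφ.contDiff.continuous hφ.hasCompactSupport
    refine h.congr (Eventually.of_forall fun q => ?_)
    simp only [hW]; ring
  -- Step D: the tested identity on the half-space `{t < T}`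
  set O : Opens (ℝ × (EuclideanSpace ℝ (Fin 3))) := slab (EuclideanSpace ℝ (Fin 3)) (Iio T) isOpen_Iio with hO
  have hmemO : ∀ q : ℝ × (EuclideanSpace ℝ (Fin 3)), q ∈ (O : Set (ℝ × (EuclideanSpace ℝ (Fin 3)))) ↔ q.1 < T := fun q => by
    rw [hO, SetLike.mem_coe, mem_slab, mem_Iio]
  have hid : ∀ θ : ℝ × (EuclideanSpace ℝ (Fin 3)) → ℝ, ContDiff ℝ ((⊤ : ℕ∞) : WithTop ℕ∞) θ → HasCompactSupport θ →
      tsupport θ ⊆ (O : Set (ℝ × (EuclideanSpace ℝ (Fin 3)))) →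
      ∫ q, θ q • (W q - V q) = 0 := by
    intro θ hθs hθc hθO
    set Θ : ℝ → (EuclideanSpace ℝ (Fin 3)) → ℝ := fun t x => θ (t, x) with hΘ
    have hΘe : uncurry Θ = θ := rfl
    have hΘt : IsSpaceTimeTestOn (⊤ : Opens (ℝ × (EuclideanSpace ℝ (Fin 3)))) Θ := ⟨hθs, hθc, by simp⟩
    -- the time support of `Θ` stays below `T`, so `𝒰[Θ]` vanishes above it
    obtain ⟨a₀, b₀, -, hb₀T, hab₀⟩ :=
      exists_time_support_lt_top (E := (EuclideanSpace ℝ (Fin 3))) (ψ := Θ) hθc (fun q hq => (hmemO q).1 (hθO hq))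
    have hU0 : ∀ s, b₀ ≤ s → ∀ x, heatDuhamelBack 1 Θ s x = 0 := fun s hs x =>
      hΘt.heatDuhamelBack_eq_zero_of_le one_pos hab₀ hs x
    -- hence `φ 𝒰[Θ]` is a test field on `Q`
    have hψ : IsSpaceTimeTestOn Qo (fun t x => φ t x * heatDuhamelBack 1 Θ t x) := by
      refine isSpaceTimeTestOn_mul_of_eq_zero_of_le hφ
        (hΘt.contDiff_uncurry_heatDuhamelBack_infty one_pos) hU0 fun q hq hqb => ?_
      obtain ⟨hq1, hq2⟩ := hφsupp q hq
      change q ∈ Ioo a T ×ˢ ball x₀ ρ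
      refine ⟨⟨by linarith, by linarith⟩, ?_⟩
      rw [mem_ball]
      linarith
    have key := integral_cutoff_mul_mul_test_eq_potentials_of_test bs hw'i hg'i heq' hφ hΘt hψ
    rw [hΘe] at key
    have hθ0 : ∀ q, θ q ≠ 0 → q.1 < T := fun q hq =>
      (hmemO q).1 (hθO (subset_tsupport _ hq))
    have t0 := integral_test_mul_fwd_eq_fwdCut (κ := UnboundedOperators.heatKernel (E := (EuclideanSpace ℝ (Fin 3)))) hθ0
      hHsupp (T := Tc) le_rfl
    have ti := fun i => integral_test_mul_fwd_eq_fwdCut (κ := heatKernelGrad (bs i)) hθ0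
      (hFsupp i) (T := Tc) le_rfl
    rw [t0, Finset.sum_congr rfl fun i _ => ti i] at key
    -- integrability of `θ · (potential)`
    have I0 : Integrable (fun q => θ q * P0 q) (volume : Measure (ℝ × (EuclideanSpace ℝ (Fin 3)))) :=
      hP0loc.integrable_smul_left_of_hasCompactSupport hθs.continuous hθc
    have Ii : ∀ i, Integrable (fun q => θ q * Pi i q) (volume : Measure (ℝ × (EuclideanSpace ℝ (Fin 3)))) := fun i =>
      (hPiloc i).integrable_smul_left_of_hasCompactSupport hθs.continuous hθc
    have IW : Integrable (fun q => θ q * W q) (volume : Measure (ℝ × (EuclideanSpace ℝ (Fin 3)))) :=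
      hWi.locallyIntegrable.integrable_smul_left_of_hasCompactSupport hθs.continuous hθc
    have eW : ∫ q, φ q.1 q.2 * w' q * θ q = ∫ q, θ q * W q := by
      refine integral_congr_ae (Eventually.of_forall fun q => ?_)
      simp only [hW]; ring
    have eV : ∫ q, θ q * V q = (∫ q, θ q * P0 q) - ∑ i, ∫ q, θ q * Pi i q := by
      rw [← integral_finsetSum _ fun i _ => Ii i, ← integral_sub I0 (integrable_finsetSum _ fun i _ => Ii i)]
      refine integral_congr_ae (Eventually.of_forall fun q => ?_)
      simp only [hV, Finset.mul_sum, mul_sub]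
    have IV : Integrable (fun q => θ q * V q) (volume : Measure (ℝ × (EuclideanSpace ℝ (Fin 3)))) :=
      hVloc.integrable_smul_left_of_hasCompactSupport hθs.continuous hθc
    simp_rw [smul_eq_mul, mul_sub]
    rw [integral_sub IW IV, ← eW, key, eV, sub_self]
  -- Step E: `W = V` a.e. on the half-space
  have hae : ∀ᵐ q ∂(volume : Measure (ℝ × (EuclideanSpace ℝ (Fin 3)))), q ∈ (O : Set (ℝ × (EuclideanSpace ℝ (Fin 3)))) → W q - V q = 0 :=
    O.isOpen.ae_eq_zero_of_integral_contDiff_smul_eq_zero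
      ((hWi.locallyIntegrable.sub hVloc).locallyIntegrableOn _) hid
  -- Step F: conclusion on `]a', T[ × B(x₀, ρ')`
  have hsub : Ioo a' T ×ˢ ball x₀ ρ' ⊆ Qs :=
    prod_mono (Ioo_subset_Ioo_left haa'.le) (ball_subset_ball hρ'ρ.le)
  have hsubO : Ioo a' T ×ˢ ball x₀ ρ' ⊆ (O : Set (ℝ × (EuclideanSpace ℝ (Fin 3)))) := fun q hq => (hmemO q).2 hq.1.2
  have hVr : MemLp V r ((volume : Measure (ℝ × (EuclideanSpace ℝ (Fin 3)))).restrict (Ioo a' T ×ˢ ball x₀ ρ')) :=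
    hVm.restrict _
  refine hVr.ae_eq ?_
  rw [Filter.EventuallyEq, ae_restrict_iff' (measurableSet_Ioo.prod measurableSet_ball)]
  filter_upwards [hae] with q hq hq'
  have h1 : W q - V q = 0 := hq (hsubO hq')
  have h2 : W q = w q := by
    have hφq : φ q.1 q.2 = 1 :=
      hφ1 q ⟨hq'.1.1.le, by linarith [hq'.1.2]⟩ hq'.2
    simp only [hW, hφq, hw', indicator_of_mem (hsub hq'), one_mul]
  linarith

end R3

end HeatDivForm

end Literature.Analysis.FluidPDE

end
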